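/-
Origin: expansion seat `planner-pub-hodgecm-mc-axioms-1-g14-0`, handover #W131 2026-08-20T15:53:55Z md5 b00163d1f22a (PKG fa58adb4a84e → b00163d1f22a; 130 l.; MECHANICAL (iib-R) rewrite v3.1 of the PKG file as it stands (41 token edits; rules R1x1+RX[h₂']x40)) (`HOME/mc/pub-hodgecm-mc-axioms-1-g14/revendor/kit-r55/stage55/HodgeCM/Model/InnerEmbReduction.lean`, md5 b00163d1f22a, 130 lines);
landed by the gen-22 packager (p-g22) in gate run 55 REPLACES the earlier landed copy of `HodgeCM/Model/InnerEmbReduction.lean` (seat copy carried the packager Origin header of an earlier run (stripped)).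
-/
/-
Origin: construction prover `planner-pub-hodgecm-mc-glue-1-g3-0` (unit pub-hodgecm-mc-glue-1-g3, node E ASSEMBLER),
2026-08-19. NEW additive KERNEL leaf of the package `HodgeCMPerL`; imports `HodgeCM.Model.EmbInstance` (E, rev-3c on
the standard Hodge model) and `HodgeCM.Model.E2Instance` (`thetaModelOf`; the pointwise binder body `ThetaModel.InnerEmbAt`).
No new hypothesis of any kind is introduced: the two `def … : Prop` below are the SHAPES of the two halves of the
inner-product identity C2, used as explicit hypotheses of the reduction theorem and discharged elsewhere
(Petersson half: tree leaf (T2) `ShimuraVarieties/UnitaryBallAdelicLiftPetersson` + `UnitaryBallWedgeFormula`;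
Betti half: tree theorem `HodgeModel.exists_trC_cup_conj_eq_mul_cintegral_topFormOfClass` at `A := stdModel`).
-/
import Summits.HodgeConjecture.HodgeCM.Model.EmbInstance_2
import Summits.HodgeConjecture.HodgeCM.Model.E2Instance

/-!
# The inner-product identity C2 for `emb := Model.embOf` — reduction to its two halves

The END-STATE binder `innerEmb` asks, at a hermitian space `V` (pointwise body `ThetaModel.InnerEmbAt V`,
`Model/EndStateLevelMeet.lean`): for every level `Γ` there is `c ≠ 0` with
`⟪emb Γ η′, emb Γ η⟫ = c · trC (η ∪ conj η′)` for all `η, η′ ∈ F²H²(X_Γ, ℂ)`.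

For the kernel map `emb := Model.embOf` (E, `Model/EmbInstance.lean`) in the anisotropic regime this identity is the
quotient of two proportionalities to the SAME geometric quantity `∫_{X_Γ^an} ω_η ∧ conj ω_{η′}` (`ω_η := embTopForm Γ η`
the holomorphic `2`-form of the class `η`, `cintegral` of `Motives/HodgeDecomposition`):

* the PETERSSON half `EmbPeterssonSide`: `⟪embAdelicLift Γ h α′, embAdelicLift Γ h α⟫ = c₁ · ∫ α ∧ conj α′` for all
  holomorphic `2`-forms `α, α′` and every continuous orientation (Borel–Wallach VII 3.2 / Baily (1973) 10.3 unfolded;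
  discharged by the tree leaf (T2) composed with `peterssonWedgeFormula_of_baily ∘ ballWedgeFormula`);
* the BETTI half `EmbBettiSide`: `trC (η ∪ conj η′) = c₂ · ∫ ω_η ∧ conj ω_{η′}` on `F²H²` for SOME continuous constant
  orientation (Voisin I §6.3.2 / Warner 5.45: the Betti trace is a non-zero multiple of integration on the line
  `H⁴`, and the cup product of classes is the class of the wedge under a MULTIPLICATIVE comparison — which is why
  E reads classes in the standard model `stdModel`, whose comparison `(stdFamily 2) ⊗ ℂ` is multiplicative).

`Model.innerEmbAt_of_sides` proves `T.InnerEmbAt V` for every theta model `T` whose `emb` is `Model.embOf` at `V`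
from these two hypotheses, with `c := c₁ / c₂`; `Model.innerEmbAt_embOf_iff_sides`-style converses are not needed.
-/

noncomputable section

open scoped TensorProduct InnerProductSpace Manifold ContDiff
open MeasureTheory
open Literature.AlgebraicGeometry.Motives
open Literature.AlgebraicGeometry.Motives.HodgeStructure (conj)
open Literature.AlgebraicGeometry.ShimuraVarieties
open Literature.AlgebraicGeometry.HodgeTheory
open Literature.Geometry.Kaehler (holFormsInCharts MForm)
open Literature.NumberTheory.Automorphic
open Literature.NumberTheory.Automorphic.PicardCM
open Literature.NumberTheory.Transcendental (IsContinuousOrientation)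
open HodgeCM.Universe (SideData ThetaModel)

namespace HodgeCM

namespace Model

variable (hHD : exists_isReal_hodgeModel) (hI : hodgePQ_independent_of_hodgeModel)
  (h₁ : BallQuotientUniformised)  (h₃ : CMAbelianVarietyRealised)

variable {L : CMField} {ι₁ : L →+* ℂ}

/-- **Petersson half of C2 (shape).** At an anisotropic `V`: for every level `Γ` and every continuous orientation
`o` of `X_Γ^an` there is `c ≠ 0` with `⟪embAdelicLift Γ h α′, embAdelicLift Γ h α⟫ = c · ∫_o α ∧ conj α′` for all
holomorphic `2`-forms `α, α′` on `X_Γ^an` (standard model, model space `ℂ²`). -/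
def EmbPeterssonSide (V : HermSpace3 L ι₁) (h : IsAnisotropic L V.Hm) : Prop :=
  ∀ (Γ : Level V)
    (o : (x : (embHodgeModel hHD h₁ h₃ Γ).carrier) →
      Orientation ℝ (TangentSpace 𝓘(ℝ, Fin 2 → ℂ) x) (Fin 4)),
    IsContinuousOrientation o →
      ∃ c : ℂ, c ≠ 0 ∧
        ∀ α α' : holFormsInCharts (Fin 2 → ℂ) (embHodgeModel hHD h₁ h₃ Γ).carrier 2,
          ⟪embAdelicLift hHD h₁ h₃ Γ h α', embAdelicLift hHD h₁ h₃ Γ h α⟫_ℂ =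
            c * cintegral o ((α : MForm 𝓘(ℝ, Fin 2 → ℂ) (embHodgeModel hHD h₁ h₃ Γ).carrier ℂ 2).wedge
              (α' : MForm 𝓘(ℝ, Fin 2 → ℂ) (embHodgeModel hHD h₁ h₃ Γ).carrier ℂ 2).conj)

/-- **Betti half of C2 (shape).** For every level `Γ` there are a constant orientation `o₀` of `ℂ² ≅ ℝ⁴`, continuous
as an orientation of `X_Γ^an`, and `c ≠ 0` with `trC (η ∪ conj η′) = c · ∫_{o₀} ω_η ∧ conj ω_{η′}` for all
`η, η′ ∈ F²H²(X_Γ, ℂ)`, `ω_η := embTopForm Γ η`. -/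
def EmbBettiSide (V : HermSpace3 L ι₁) : Prop :=
  ∀ Γ : Level V,
    ∃ (o₀ : Orientation ℝ (Fin 2 → ℂ) (Fin 4)) (c : ℂ),
      IsContinuousOrientation (I := 𝓘(ℝ, Fin 2 → ℂ)) (M := (embHodgeModel hHD h₁ h₃ Γ).carrier)
          (fun _ ↦ o₀) ∧ c ≠ 0 ∧
        ∀ η η' : (picardCMUniverse hHD hI h₁ h₃).CohC ((picardCMUniverse hHD hI h₁ h₃).pms L ι₁ V Γ) 2,
          η ∈ ((picardCMUniverse hHD hI h₁ h₃).hodge ((picardCMUniverse hHD hI h₁ h₃).pms L ι₁ V Γ) 2).F 2 →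
          η' ∈ ((picardCMUniverse hHD hI h₁ h₃).hodge ((picardCMUniverse hHD hI h₁ h₃).pms L ι₁ V Γ) 2).F 2 →
            (picardCMUniverse hHD hI h₁ h₃).trC ((picardCMUniverse hHD hI h₁ h₃).pms L ι₁ V Γ) 4
                ((picardCMUniverse hHD hI h₁ h₃).cup2C ((picardCMUniverse hHD hI h₁ h₃).pms L ι₁ V Γ) 2
                  η (conj η')) =
              c * cintegral (fun _ : (embHodgeModel hHD h₁ h₃ Γ).carrier ↦ o₀)
                ((embTopForm hHD hI h₁ h₃ Γ η :
                    MForm 𝓘(ℝ, Fin 2 → ℂ) (embHodgeModel hHD h₁ h₃ Γ).carrier ℂ 2).wedge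
                  (embTopForm hHD hI h₁ h₃ Γ η' :
                    MForm 𝓘(ℝ, Fin 2 → ℂ) (embHodgeModel hHD h₁ h₃ Γ).carrier ℂ 2).conj)

/-- **C2 for `embOf` from its two halves.** For the END STATE's theta model built on `emb := Model.embOf` (any
`cover`, `wm`, `Theta`, side data and bit), at an anisotropic hermitian space `V`, the Petersson half and the Betti
half of the inner-product identity give `InnerEmbAt V`, with constant `c₁ / c₂` at each level. -/
theorem innerEmbAt_of_sides (hb : Bool)
    (cover : ∀ {L : CMField} {ι₁ : L →+* ℂ} {V : HermSpace3 L ι₁} (Γ Γ' : Level V),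
      Γ'.Γ ≤ Γ.Γ → (picardCMUniverse hHD hI h₁ h₃).Mor ((picardCMUniverse hHD hI h₁ h₃).pms L ι₁ V Γ')
        ((picardCMUniverse hHD hI h₁ h₃).pms L ι₁ V Γ))
    (wm : ∀ {L : CMField} {ι₁ : L →+* ℂ} (V : HermSpace3 L ι₁) (c : SeesawCtx L),
      WeilThetaModel (V.latticeModel printFact_unitaryCompact_holds).toQuotientModel.G
        (V.latticeModel printFact_unitaryCompact_holds).toQuotientModel.Γ
        (c.D.latticeModelW printFact_unitaryCompact_holds).toQuotientModel.G
        (c.D.latticeModelW printFact_unitaryCompact_holds).toQuotientModel.Γ)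
    (Theta : ∀ {L : CMField} {ι₁ : L →+* ℂ} (V : HermSpace3 L ι₁), SeesawCtx L → Fin 4 → ∀ Γ : Level V,
      Set ((picardCMUniverse hHD hI h₁ h₃).CohC ((picardCMUniverse hHD hI h₁ h₃).pms L ι₁ V Γ) 1))
    (d12 d34 : ∀ {L : CMField}, SeesawCtx L → SideData L)
    (V : HermSpace3 L ι₁) (h : IsAnisotropic L V.Hm)
    (hPet : EmbPeterssonSide hHD h₁ h₃ V h) (hBetti : EmbBettiSide hHD hI h₁ h₃ V) :
    (thetaModelOf hHD hI h₁ h₃ hb (embOf hHD hI h₁ h₃) cover wm Theta d12 d34).InnerEmbAt V := by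
  intro Γ
  obtain ⟨o₀, c₂, ho, hc₂, hB⟩ := hBetti Γ
  obtain ⟨c₁, hc₁, hP⟩ := hPet Γ (fun _ ↦ o₀) ho
  refine ⟨c₁ / c₂, div_ne_zero hc₁ hc₂, fun η η' hη hη' ↦ ?_⟩
  rw [show (thetaModelOf hHD hI h₁ h₃ hb (embOf hHD hI h₁ h₃) cover wm Theta d12 d34).emb Γ =
      embOf hHD hI h₁ h₃ Γ from rfl,
    embOf_of_isAnisotropic hHD hI h₁ h₃ Γ h]
  erw [inner_embLift hHD hI h₁ h₃ Γ h η η']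
  rw [hP (embTopForm hHD hI h₁ h₃ Γ η) (embTopForm hHD hI h₁ h₃ Γ η'), hB η η' hη hη']
  field_simp

end Model

end HodgeCM

end
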